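import Mathlib

/-!
# The Frobenius sandwich (card `inseparability-foliation-sandwich`, first lemma)

Route `SeparableGalois`, crux `GaloisQuotientModels` (item stmt-ResolutionOfSingularities-18955),
line Sketch, stub `stub_sandwich`. Pure field theory: `G` a finite group acting on a field `L` of
characteristic `p`, `K₁ := L^G = FixedPoints.subfield G L`, `K₂ ≤ K₁` a subfield with
`K₁^p ⊆ K₂`. The Frobenius sandwich `L₂ := K₂ ⊔ L^p` (`L^p = (frobenius L p).fieldRange`)
is `G`-stable and `L₂ ⊓ K₁ = K₂` (so `L₂^G = K₂` and `L₂ / K₂` is Galois with group `G`: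
de Jong's purely inseparable defect `K₂ ⊊ K₁` disappears at the level of fields).

Proof. Stability: the preimage of `L₂` under the ring endomorphism `a ↦ g • a` is a subfield
containing `K₂` (fixed pointwise) and `L^p` (`g • b^p = (g • b)^p`). Intersection: `⊇` is
`K₂ ≤ L₂` and `K₂ ≤ K₁`. For `⊆`: every `b^p ∈ L^p` is separable over `K₂` — the minimal
polynomial of `b` over `K₁` is separable (Artin: `L / L^G` is separable) and pushing its
coefficients through the Frobenius `K₁ → K₂, e ↦ e^p` (well defined since `K₁^p ⊆ K₂`)
gives a separable polynomial over `K₂` with root `b^p`. Hence `L₂ ≤ separableClosure K₂ L`;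
every `x ∈ K₁` has `x^p ∈ K₂`, i.e. lies in `perfectClosure K₂ L`; and
`separableClosure K₂ L ⊓ perfectClosure K₂ L = ⊥`.

Not here: the degree count `[L : L₂] = [K₁ : K₂]` and anything geometric (the inseparability
foliation `Der(L/L₂)` of the card lives elsewhere).
-/

set_option linter.dupNamespace false -- mandated namespace of this single-conjunct summit

namespace Summit.ResolutionOfSingularities.ResolutionOfSingularities.Theorems.GaloisQuotientModels.InseparabilityFoliation

open Polynomial

/-- **Frobenius sandwich** (first lemma of card `inseparability-foliation-sandwich`). `G` a
finite group of automorphisms of a field `L` of characteristic `p`, `K₁ = L^G`, `K₂ ⊆ K₁` a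
subfield with `K₁^p ⊆ K₂`, `L₂ := K₂ ⊔ L^p`. Then `L₂` is `G`-stable and `L₂ ⊓ K₁ = K₂`.
Proof: stability is `g • b^p = (g • b)^p`; for the intersection, `L₂` is separable over `K₂`
(the image under the Frobenius `K₁ → K₂` of the separable minimal polynomial of `b` over
`K₁ = L^G` kills `b^p`) while `K₁` is purely inseparable over `K₂` (`K₁^p ⊆ K₂`), and
`separableClosure ⊓ perfectClosure = ⊥`. [folklore] -/
theorem stub_sandwich (p : ℕ) [Fact p.Prime] (L : Type) [Field L] [CharP L p]
    (G : Type) [Group G] [Finite G] [MulSemiringAction G L] [FaithfulSMul G L]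
    (K₂ : Subfield L) (hK₂ : K₂ ≤ FixedPoints.subfield G L)
    (hpow : ∀ a ∈ FixedPoints.subfield G L, a ^ p ∈ K₂) :
    let L₂ : Subfield L := K₂ ⊔ (frobenius L p).fieldRange
    (∀ g : G, ∀ a ∈ L₂, g • a ∈ L₂) ∧ L₂ ⊓ FixedPoints.subfield G L = K₂ := by
  intro L₂
  refine ⟨fun g => ?_, le_antisymm ?_ (le_inf le_sup_left hK₂)⟩
  · -- `G`-stability: `L₂` lies in its preimage under the ring endomorphism `a ↦ g • a`
    have h : L₂ ≤ L₂.comap (MulSemiringAction.toRingHom G L g) := by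
      refine sup_le (fun a ha => ?_) ?_
      · rw [Subfield.mem_comap, MulSemiringAction.toRingHom_apply, hK₂ ha g]
        exact (le_sup_left : K₂ ≤ L₂) ha
      · rintro _ ⟨b, rfl⟩
        rw [Subfield.mem_comap, MulSemiringAction.toRingHom_apply, frobenius_def, smul_pow']
        exact (le_sup_right : (frobenius L p).fieldRange ≤ L₂) ⟨g • b, rfl⟩
    exact fun a ha => h ha
  · -- `L₂ ⊓ K₁ ≤ K₂`: separable meets purely inseparable
    rintro x ⟨hx₂, hx₁⟩
    have hsep : L₂ ≤ (separableClosure K₂ L).toSubfield := by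
      refine sup_le (fun a ha => ?_) ?_
      · rw [IntermediateField.mem_toSubfield, mem_separableClosure_iff]
        exact isSeparable_algebraMap (⟨a, ha⟩ : K₂)
      · rintro _ ⟨b, rfl⟩
        rw [IntermediateField.mem_toSubfield, mem_separableClosure_iff]
        -- the Frobenius `K₁ → K₂`, `e ↦ e ^ p`
        let φ : FixedPoints.subfield G L →+* K₂ :=
          ((frobenius L p).comp (FixedPoints.subfield G L).subtype).codRestrict K₂
            fun e => hpow e e.2
        have hφ : (algebraMap K₂ L).comp φ =
            (frobenius L p).comp (algebraMap (FixedPoints.subfield G L) L) :=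
          RingHom.ext fun _ => rfl
        have hf : (minpoly (FixedPoints.subfield G L) b).Separable :=
          Algebra.IsSeparable.isSeparable _ b
        have hroot :
            aeval (frobenius L p b) ((minpoly (FixedPoints.subfield G L) b).map φ) = 0 := by
          rw [aeval_def, eval₂_map, hφ, ← hom_eval₂, ← aeval_def, minpoly.aeval, map_zero]
        exact hf.map.of_dvd (minpoly.dvd K₂ _ hroot)
    have h₁ : x ∈ separableClosure K₂ L := hsep hx₂
    have h₂ : x ∈ perfectClosure K₂ L :=
      (mem_perfectClosure_iff_pow_mem p).2 ⟨1, ⟨x ^ p, hpow x hx₁⟩, by rw [pow_one]; rfl⟩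
    have h₃ : x ∈ separableClosure K₂ L ⊓ perfectClosure K₂ L :=
      IntermediateField.mem_inf.2 ⟨h₁, h₂⟩
    rw [separableClosure_inf_perfectClosure, IntermediateField.mem_bot] at h₃
    obtain ⟨y, rfl⟩ := h₃
    exact y.2

end Summit.ResolutionOfSingularities.ResolutionOfSingularities.Theorems.GaloisQuotientModels.InseparabilityFoliation
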